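import Summits.NavierStokesRegularity.NavierStokesRegularity.Theorems.TypeIIInviscidRelaxationAxisymSwirlRegularJetCriterion
import HarnessLib

/-!
# Crux `AxisymSwirlRegular` (stmt-NavierStokesRegularity-1964), line `radial_inflow_split`:
# the one-wall / jet criterion near the blow-up time, far field and early times discharged

`--supports stmt-NavierStokesRegularity-1964` (helper file; theorems only, no definitions).

The criteria of `…WallFloorCriterion.lean` / `…JetCriterion.lean` ask `r u_r ≥ −L` also in the far region of
the tube and on the whole tube initially. Both are automatic for thin tubes: `u` is bounded near `T` outside
a large ball (`axisymmetricL3_boundedNearTop_infinity`) and on `[0, T₁] × ℝ³` (sub-slab bound), and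
`|r u_r| ≤ r|u|`. Running the maximum principle from a time `T₁` close to `T`
(`radialMomentum_minPrinciple_engine_jet_from`) leaves exactly two data on a thin tube near `T`: the
inflow level on ONE bounded cylinder wall `{r = δ₁, |x| ≤ R} × [T₁,T)` and the pressure-pull excess at
the strongest-inflow points of the jet (`hasSmoothExtensionPast_of_wallInflow_nearTop`). No route item is
closed; NS regularity is not touched.
-/

noncomputable section

open Literature.Analysis.FluidPDE MeasureTheory Set Function Filter Topology Metric WithLp
open scoped InnerProductSpace RealInnerProductSpace Laplacian ContDiff

namespace Summit.NavierStokesRegularity.NavierStokesRegularity.Theorems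

-- the problem directory repeats the summit name (`NavierStokesRegularity/NavierStokesRegularity`)
set_option linter.dupNamespace false

/-- **The jet engine started at a later time `T₁ ∈ [0,T)`**: as `radialMomentum_minPrinciple_engine_jet`
(`…JetCriterion.lean`) on `[T₁, t] × K` — floor data on `[T₁,T)`, initial data at `T₁`,
`G(s) = ∫_{T₁}^s g`. [new] -/
theorem radialMomentum_minPrinciple_engine_jet_from {ν T : ℝ} {u : ℝ → EuclideanSpace ℝ (Fin 3) → EuclideanSpace ℝ (Fin 3)} {p : ℝ → EuclideanSpace ℝ (Fin 3) → ℝ}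
    (H : AxisymmetricL3Hyp ν T u p) {T₁ δ₁ R L I : ℝ} (hT₁ : T₁ ∈ Ico 0 T)
    {g : ℝ → ℝ} (hgc : ContinuousOn g (Ico T₁ T)) (hg0 : ∀ t ∈ Ico T₁ T, 0 ≤ g t)
    (hgI : ∀ t ∈ Ico T₁ T, ∫ s in T₁..t, g s ≤ I)
    (hfloor : ∀ t ∈ Ico T₁ T, ∀ x ∈ ball (0 : EuclideanSpace ℝ (Fin 3)) R ∩ {x | cylRadius x < δ₁},
      cylRadius x ≠ 0 → x 0 * u t x 0 + x 1 * u t x 1 < -L →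
      fderiv ℝ (fun z : EuclideanSpace ℝ (Fin 3) => z 0 * u t z 0 + z 1 * u t z 1) x = 0 →
      0 ≤ (Δ (fun z : EuclideanSpace ℝ (Fin 3) => z 0 * u t z 0 + z 1 * u t z 1)) x →
      -g t ≤ (u t x 0) ^ 2 + (u t x 1) ^ 2
        - (x 0 * fderiv ℝ (p t) x (EuclideanSpace.single 0 1)
            + x 1 * fderiv ℝ (p t) x (EuclideanSpace.single 1 1)))
    (hlat : ∀ t ∈ Ico T₁ T, ∀ x ∈ (closedBall (0 : EuclideanSpace ℝ (Fin 3)) R ∩ {x | cylRadius x ≤ δ₁}) \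
      (ball (0 : EuclideanSpace ℝ (Fin 3)) R ∩ {x | cylRadius x < δ₁}), -L ≤ x 0 * u t x 0 + x 1 * u t x 1)
    (hbot : ∀ x ∈ closedBall (0 : EuclideanSpace ℝ (Fin 3)) R ∩ {x | cylRadius x ≤ δ₁},
      -L ≤ x 0 * u T₁ x 0 + x 1 * u T₁ x 1) :
    ∀ t ∈ Ico T₁ T, ∀ x ∈ closedBall (0 : EuclideanSpace ℝ (Fin 3)) R ∩ {x | cylRadius x ≤ δ₁},
      -(L + I) ≤ x 0 * u t x 0 + x 1 * u t x 1 := by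
  intro t ht x hx
  set K : Set (EuclideanSpace ℝ (Fin 3)) := closedBall (0 : EuclideanSpace ℝ (Fin 3)) R ∩ {x | cylRadius x ≤ δ₁} with hK_def
  set U : Set (EuclideanSpace ℝ (Fin 3)) := ball (0 : EuclideanSpace ℝ (Fin 3)) R ∩ {x | cylRadius x < δ₁} with hU_def
  set G : ℝ → ℝ := fun s => ∫ τ in T₁..s, g τ with hG_def
  set w : ℝ → EuclideanSpace ℝ (Fin 3) → ℝ := fun s y => -(y 0 * u s y 0 + y 1 * u s y 1) - G s - L with hw_def
  set wt : ℝ → EuclideanSpace ℝ (Fin 3) → ℝ := fun s y =>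
    -(y 0 * timeDerivWithin (Ico 0 T) u s y 0 + y 1 * timeDerivWithin (Ico 0 T) u s y 1) - g s
    with hwt_def
  have hν := H.viscosity_pos
  have hsm := H.classical.smooth_velocity
  have htT : Icc T₁ t ⊆ Ico T₁ T := fun s hs => ⟨hs.1, hs.2.trans_lt ht.2⟩
  have htT0 : Icc T₁ t ⊆ Ico 0 T := fun s hs => ⟨hT₁.1.trans hs.1, hs.2.trans_lt ht.2⟩
  -- the time integral of the floor
  have hG0 : G T₁ = 0 := intervalIntegral.integral_same
  have hGnn : ∀ s ∈ Icc T₁ t, 0 ≤ G s := fun s hs =>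
    intervalIntegral.integral_nonneg hs.1 fun τ hτ => hg0 τ ⟨hτ.1, hτ.2.trans_lt (hs.2.trans_lt ht.2)⟩
  -- the sets
  have hK : IsCompact K :=
    (isCompact_closedBall _ _).inter_right (isClosed_le continuous_cylRadius continuous_const)
  have hU : IsOpen U := isOpen_ball.inter (isOpen_lt continuous_cylRadius continuous_const)
  have hUK : U ⊆ K := fun y hy =>
    ⟨ball_subset_closedBall hy.1, (le_of_lt (hy.2 : cylRadius y < δ₁) : cylRadius y ≤ δ₁)⟩
  -- joint continuity of `w` on `[0,t] × K`
  have hc : ContinuousOn (uncurry w) (Icc T₁ t ×ˢ K) := by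
    have hu : ContinuousOn (uncurry u) (Icc T₁ t ×ˢ K) :=
      hsm.continuousOn.mono (prod_mono htT0 (subset_univ _))
    have h0 : ContinuousOn (fun q : ℝ × EuclideanSpace ℝ (Fin 3) => uncurry u q 0) (Icc T₁ t ×ˢ K) :=
      (EuclideanSpace.proj (0 : Fin 3)).continuous.comp_continuousOn hu
    have h1 : ContinuousOn (fun q : ℝ × EuclideanSpace ℝ (Fin 3) => uncurry u q 1) (Icc T₁ t ×ˢ K) :=
      (EuclideanSpace.proj (1 : Fin 3)).continuous.comp_continuousOn hu
    have hy0 : Continuous (fun q : ℝ × EuclideanSpace ℝ (Fin 3) => q.2 0) := (EuclideanSpace.proj (0 : Fin 3)).continuous.comp continuous_snd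
    have hy1 : Continuous (fun q : ℝ × EuclideanSpace ℝ (Fin 3) => q.2 1) := (EuclideanSpace.proj (1 : Fin 3)).continuous.comp continuous_snd
    have hGc : ContinuousOn G (Icc T₁ t) := by
      have hint : IntegrableOn g (uIcc T₁ t) := by
        rw [uIcc_of_le ht.1]
        exact (hgc.mono htT).integrableOn_compact isCompact_Icc
      have := intervalIntegral.continuousOn_primitive_interval (μ := volume) hint
      rwa [uIcc_of_le ht.1] at this
    have hGc' : ContinuousOn (fun q : ℝ × EuclideanSpace ℝ (Fin 3) => G q.1) (Icc T₁ t ×ˢ K) :=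
      hGc.comp continuous_fst.continuousOn fun q hq => hq.1
    have e : uncurry w = fun q : ℝ × EuclideanSpace ℝ (Fin 3) =>
        -(q.2 0 * uncurry u q 0 + q.2 1 * uncurry u q 1) - G q.1 - L := by
      funext q
      rfl
    rw [e]
    exact ((((hy0.continuousOn.mul h0).add (hy1.continuousOn.mul h1)).neg.sub hGc').sub
      continuousOn_const)
  -- slice regularity
  have h2 : ∀ s ∈ Ioc T₁ t, ∀ y ∈ U, ContDiffAt ℝ 2 (w s) y := by
    intro s hs y _
    have hs' : s ∈ Ico 0 T := ⟨hT₁.1.trans hs.1.le, hs.2.trans_lt ht.2⟩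
    have hU2 : ContDiff ℝ 2 (u s) := (H.classical.contDiff_velocity hs').of_le (by norm_cast)
    exact (((contDiff_radialMomentum hU2).neg.sub contDiff_const).sub contDiff_const).contDiffAt
  -- the left time derivative
  have hderiv : ∀ s ∈ Ioc T₁ t, ∀ y ∈ U,
      HasDerivWithinAt (fun τ => w τ y) (wt s y) (Icc T₁ s) s := by
    intro s hs y _
    have hs' : s ∈ Ico 0 T := ⟨hT₁.1.trans hs.1.le, hs.2.trans_lt ht.2⟩
    have hsT : s ∈ Ioo T₁ T := ⟨hs.1, hs.2.trans_lt ht.2⟩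
    have hΦ := (hasDerivWithinAt_radialMomentum hsm hs' y).mono
      (show Icc T₁ s ⊆ Ico 0 T from fun τ hτ => ⟨hT₁.1.trans hτ.1, hτ.2.trans_lt hsT.2⟩)
    have hgs : ContinuousAt g s :=
      (hgc.mono Ioo_subset_Ico_self).continuousAt (isOpen_Ioo.mem_nhds hsT)
    have hmeas : StronglyMeasurableAtFilter g (𝓝 s) volume :=
      (hgc.mono Ioo_subset_Ico_self).stronglyMeasurableAtFilter isOpen_Ioo _ hsT
    have hii : IntervalIntegrable g volume T₁ s := by
      refine (hgc.mono ?_).intervalIntegrable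
      rw [uIcc_of_le hs.1.le]
      exact fun τ hτ => ⟨hτ.1, hτ.2.trans_lt hsT.2⟩
    have hG : HasDerivAt G (g s) s := intervalIntegral.integral_hasDerivAt_right hii hmeas hgs
    exact (hΦ.neg.sub hG.hasDerivWithinAt).sub_const L
  -- the sub-solution property at interior critical points
  have hsub : ∀ s ∈ Ioc T₁ t, ∀ y ∈ U, 0 < w s y → fderiv ℝ (w s) y = 0 → (Δ (w s)) y ≤ 0 →
      wt s y ≤ 0 := by
    intro s hs y hy hwpos hgrad hlap
    have hs' : s ∈ Ico 0 T := ⟨hT₁.1.trans hs.1.le, hs.2.trans_lt ht.2⟩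
    have hs'' : s ∈ Ico T₁ T := ⟨hs.1.le, hs.2.trans_lt ht.2⟩
    have hU2 : ContDiff ℝ 2 (u s) := (H.classical.contDiff_velocity hs').of_le (by norm_cast)
    have hΦ2 : ContDiff ℝ 2 (fun z : EuclideanSpace ℝ (Fin 3) => z 0 * u s z 0 + z 1 * u s z 1) :=
      contDiff_radialMomentum hU2
    have hw_eq : w s = fun z => -(z 0 * u s z 0 + z 1 * u s z 1) - (G s + L) := by
      funext z
      simp only [hw_def]
      ring
    have hgradΦ : fderiv ℝ (fun z : EuclideanSpace ℝ (Fin 3) => z 0 * u s z 0 + z 1 * u s z 1) y = 0 := by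
      have e : fderiv ℝ (w s) y = -fderiv ℝ (fun z : EuclideanSpace ℝ (Fin 3) => z 0 * u s z 0 + z 1 * u s z 1) y := by
        rw [hw_eq, fderiv_sub_const, fderiv_fun_neg]
      rw [e] at hgrad
      exact neg_eq_zero.1 hgrad
    have hlapΦ : 0 ≤ (Δ (fun z : EuclideanSpace ℝ (Fin 3) => z 0 * u s z 0 + z 1 * u s z 1)) y := by
      have e : (Δ (w s)) y = -(Δ (fun z : EuclideanSpace ℝ (Fin 3) => z 0 * u s z 0 + z 1 * u s z 1)) y := by
        rw [hw_eq]
        exact laplacian_neg_sub_const hΦ2 _ y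
      rw [e] at hlap
      linarith
    have hg0s := hg0 s hs''
    by_cases hax : cylRadius y = 0
    · obtain ⟨h0, h1⟩ := (cylRadius_eq_zero_iff y).1 hax
      simp only [hwt_def, h0, h1, zero_mul, add_zero, neg_zero, zero_sub]
      linarith
    · have hUD : UniqueDiffWithinAt ℝ (Ico 0 T) s := uniqueDiffOn_Ico 0 T s hs'
      have hcrit := timeDerivWithin_radialMomentum_of_critical H.classical hs' hUD
        (H.axisymmetric s hs') hax hgradΦ
      have e := timeDerivWithin_radialMomentum hsm hs' hUD y
      have hΦlt : y 0 * u s y 0 + y 1 * u s y 1 < -L := by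
        have hG := hGnn s ⟨hs.1.le, hs.2⟩
        simp only [hw_def] at hwpos
        linarith
      have hfl := hfloor s hs'' y hy hax hΦlt hgradΦ hlapΦ
      have hνΔ : 0 ≤ ν * (Δ (fun z : EuclideanSpace ℝ (Fin 3) => z 0 * u s z 0 + z 1 * u s z 1)) y :=
        mul_nonneg hν.le hlapΦ
      simp only [hwt_def]
      rw [← e, hcrit]
      simp only [Pi.zero_apply, PiLp.zero_apply, mul_zero, add_zero]
      linarith
  -- the parabolic boundary
  have hbot' : ∀ y ∈ K, w T₁ y ≤ 0 := by
    intro y hy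
    have h := hbot y hy
    simp only [hw_def, hG0]
    linarith
  have hlat' : ∀ s ∈ Icc T₁ t, ∀ y ∈ K \ U, w s y ≤ 0 := by
    intro s hs y hy
    have h := hlat s (htT hs) y hy
    have hG := hGnn s hs
    simp only [hw_def]
    linarith
  -- the weak maximum principle
  have key := weak_max_principle_of_contDiffAt_of_pos hK hU hUK hc h2 hderiv hsub hbot' hlat' t
    ⟨ht.1, le_rfl⟩ x hx
  have hGI : G t ≤ I := hgI t ht
  simp only [hw_def] at key
  linarith



/-- **Continuation criterion near the blow-up time, without far-field or initial hypotheses.** In the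
standing class (`AxisymmetricL3Hyp` + rapidly decaying datum), for every level `L > 0` there are
`δ₀ > 0`, a radius `R` and a time `T₁ ∈ [0,T)` (depending on the solution: far-field bound near `T`,
sub-slab bound up to `T₁`) such that for every tube radius `δ₁ ∈ (0, δ₀]`: if `r u_r ≥ −L` on the bounded
wall piece `{r = δ₁, |x| ≤ R} × [T₁,T)`, and the cyclostrophic defect has a continuous floor `−g(t)`,
`∫_{T₁}^t g ≤ I`, at the strongest-inflow points of the jet `{r u_r < −L} ∩ B(0,R)` on `[T₁,T)`, with
`L + I < 2ν`, then the solution extends past `T`. (The far region, the times before `T₁` and the slice `T₁`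
are handled by the tree's far-field bound `axisymmetricL3_boundedNearTop_infinity` and the sub-slab bound,
through the smallness of `δ₁`.) Contrapositive: an axisymmetric blow-up at `T` shows, on EVERY sufficiently
thin bounded cylinder wall near `T`, inflow `r u_r < −L`, or else a jet pressure-pull excess `≥ 2ν − L`. [new] -/
theorem hasSmoothExtensionPast_of_wallInflow_nearTop {ν T : ℝ}
    {u : ℝ → EuclideanSpace ℝ (Fin 3) → EuclideanSpace ℝ (Fin 3)} {p : ℝ → EuclideanSpace ℝ (Fin 3) → ℝ}
    (H : AxisymmetricL3Hyp ν T u p) (hdec : HasRapidSpatialDecay (u 0)) {L : ℝ} (hL : 0 < L) :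
    ∃ δ₀ R T₁ : ℝ, 0 < δ₀ ∧ T₁ ∈ Ico 0 T ∧ ∀ ⦃δ₁ I : ℝ⦄ ⦃g : ℝ → ℝ⦄, 0 < δ₁ → δ₁ ≤ δ₀ →
      ContinuousOn g (Ico T₁ T) → (∀ t ∈ Ico T₁ T, 0 ≤ g t) → (∀ t ∈ Ico T₁ T, ∫ s in T₁..t, g s ≤ I) →
      (∀ t ∈ Ico T₁ T, ∀ x, cylRadius x = δ₁ → ‖x‖ ≤ R → -L ≤ x 0 * u t x 0 + x 1 * u t x 1) →
      (∀ t ∈ Ico T₁ T, ∀ x ∈ ball (0 : EuclideanSpace ℝ (Fin 3)) R ∩ {x | cylRadius x < δ₁},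
        cylRadius x ≠ 0 → x 0 * u t x 0 + x 1 * u t x 1 < -L →
        fderiv ℝ (fun z : EuclideanSpace ℝ (Fin 3) => z 0 * u t z 0 + z 1 * u t z 1) x = 0 →
        0 ≤ (Δ (fun z : EuclideanSpace ℝ (Fin 3) => z 0 * u t z 0 + z 1 * u t z 1)) x →
        -g t ≤ (u t x 0) ^ 2 + (u t x 1) ^ 2
          - (x 0 * fderiv ℝ (p t) x (EuclideanSpace.single 0 1)
              + x 1 * fderiv ℝ (p t) x (EuclideanSpace.single 1 1))) →
      L + I < 2 * ν → HasSmoothExtensionPast ν 0 u T := by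
  have hν := H.viscosity_pos
  have hT := H.time_pos
  obtain ⟨R₀, r₁, K₁, hr₁, hfar⟩ := axisymmetricL3_boundedNearTop_infinity H
  have hr₁2 : 0 < r₁ ^ 2 := pow_pos hr₁ 2
  set T₁ : ℝ := max (T - r₁ ^ 2 / 2) 0 with hT₁_def
  have hT₁ : T₁ ∈ Ico 0 T := ⟨le_max_right _ _, max_lt (by linarith) hT⟩
  have hT₁far : T - r₁ ^ 2 < T₁ := lt_of_lt_of_le (by linarith) (le_max_left _ _)
  obtain ⟨B, hB⟩ := H.bounded_subslab T₁ hT₁.2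
  set M : ℝ := max (max K₁ B) 0 with hM_def
  have hM0 : 0 ≤ M := le_max_right _ _
  have hK₁M : K₁ ≤ M := (le_max_left _ _).trans (le_max_left _ _)
  have hBM : B ≤ M := (le_max_right _ _).trans (le_max_left _ _)
  set R : ℝ := max R₀ 0 with hR_def
  refine ⟨L / (M + 1), R, T₁, div_pos hL (by linarith), hT₁, ?_⟩
  intro δ₁ I g hδ₁ hδ₁0 hgc hg0 hgI hwall hfloor hbudget
  have hδM : δ₁ * M ≤ L := by
    have h1 : δ₁ * M ≤ L / (M + 1) * M := mul_le_mul_of_nonneg_right hδ₁0 hM0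
    have h2 : L / (M + 1) * M ≤ L := by
      rw [div_mul_eq_mul_div, div_le_iff₀ (by linarith)]
      nlinarith
    linarith
  have hI0 : 0 ≤ I := by
    have h := hgI T₁ ⟨le_rfl, hT₁.2⟩
    rwa [intervalIntegral.integral_same] at h
  -- `Φ ≥ −L` wherever `|u| ≤ M` on the tube
  have hΦM : ∀ (t : ℝ) (x : EuclideanSpace ℝ (Fin 3)), cylRadius x ≤ δ₁ → ‖u t x‖ ≤ M →
      -L ≤ x 0 * u t x 0 + x 1 * u t x 1 := by
    intro t x hx hu
    have h := radialMomentum_ge_neg_mul_of_norm_le hx hu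
    linarith
  have hearly : ∀ t ∈ Icc 0 T₁, ∀ x, ‖u t x‖ ≤ M := fun t ht x => (hB t ht x).trans hBM
  have hfarM : ∀ t ∈ Ico T₁ T, ∀ x, R ≤ ‖x‖ → ‖u t x‖ ≤ M := fun t ht x hx =>
    (hfar t ⟨hT₁far.trans_le ht.1, ht.2⟩ x ((le_max_left _ _).trans hx)).trans hK₁M
  -- the engine on `[T₁, T) × (B̄(0,R) ∩ {r ≤ δ₁})`
  have key := radialMomentum_minPrinciple_engine_jet_from H hT₁ hgc hg0 hgI hfloor
    (fun t ht x hx => by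
      have hr : cylRadius x ≤ δ₁ := hx.1.2
      have hxR' : ‖x‖ ≤ R := mem_closedBall_zero_iff.1 hx.1.1
      by_cases hxR : R ≤ ‖x‖
      · exact hΦM t x hr (hfarM t ht x hxR)
      · have hxb : x ∈ ball (0 : EuclideanSpace ℝ (Fin 3)) R := mem_ball_zero_iff.2 (lt_of_not_ge hxR)
        have hge : δ₁ ≤ cylRadius x := by
          by_contra hlt
          exact hx.2 ⟨hxb, lt_of_not_ge hlt⟩
        exact hwall t ht x (le_antisymm hr hge) hxR')
    (fun x hx => hΦM T₁ x hx.2 (hearly T₁ ⟨hT₁.1, le_rfl⟩ x))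
  -- the one-sided radial criterion with the constant `(L + I)/ν < 2`
  have hC : (L + I) / ν < 2 := by
    rw [div_lt_iff₀ hν]
    linarith
  refine ScenarioCensus.LogGate.oneSidedRadialCriterion_of_lt_two (C := (L + I) / ν) hν hT hC hδ₁
    H.classical H.lerayHopf H.bounded_subslab H.axisymmetric hdec fun t ht x hx => ?_
  have hCν : (L + I) / ν * ν = L + I := div_mul_cancel₀ _ hν.ne'
  rw [hCν]
  by_cases htT₁ : t < T₁
  · have h := hΦM t x (le_of_lt hx) (hearly t ⟨ht.1, htT₁.le⟩ x)
    linarith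
  · have ht' : t ∈ Ico T₁ T := ⟨le_of_not_gt htT₁, ht.2⟩
    by_cases hxR : ‖x‖ ≤ R
    · exact key t ht' x ⟨mem_closedBall_zero_iff.2 hxR, (le_of_lt hx : cylRadius x ≤ δ₁)⟩
    · have h := hΦM t x (le_of_lt hx) (hfarM t ht' x (le_of_not_ge hxR))
      linarith

end Summit.NavierStokesRegularity.NavierStokesRegularity.Theorems

end
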